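import Mathlib.Analysis.Complex.Exponential
import Mathlib.Analysis.SpecificLimits.Basic
import Summits.QuantumFields.YangMills.Theorems.SmallCircleAnchorAnchorGapTreeWeightPolymerSum

/-!
# Crux `AnchorGap` (stmt-QuantumFields-11141), line `registered` — the per-atom PINNED TREE-SUM
# CRITERION from TREESUM (the geometric series behind the Kotecký–Preiss condition)

Generic arithmetic consuming the landed stub `stub_treeWeightPolymerSum` (TREESUM): if an activity
majorant has the shape delivered by the activity tree bound (GBND),
`F X ≤ A · q^{|X|} · Σ_{T ∈ lineSets (min X) X} ∏_{ℓ∈T} y_ℓ` (`|X| ≥ 2`), for pair weights `y ≥ 0`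
with row sums `≤ Y`, then for every atom `c`

* `sum_pinned_card_le` — `Σ_{X ∋ c, |X| = n} F X ≤ A qⁿ · n^{n−2}/(n−1)! · n · Y^{n−1}` (TREESUM);
* `pow_div_factorial_le_exp_pow` — `n^{n−1}/(n−1)! · (…) ≤ eⁿ`-type bound: `n^{n−2}·n·/(n−1)! ≤ eⁿ`
  (`Real.pow_div_factorial_le_exp` at `x = n`);
* `sum_pinned_le_sum_Ico` — `Σ_{X ∋ c, 2 ≤ |X|} F X ≤ A Σ_{n=2}^{|β|} (qe)ⁿ Y^{n−1}`;
* `sum_pinned_le_geometric` — **the pinned criterion in closed form**: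
  `Σ_{X ∋ c, 2 ≤ |X|} F X ≤ A (qe)² Y / (1 − qeY)` whenever `qeY < 1` — small with `Y`, which is the
  input `∀ c, Σ_{X ∋ c} K̄ X·(weights) ≤ τ` of the Kotecký–Preiss packaging of the atom gas
  (`LoopLedgerGasOfAtomGas.kpGasOn_of_atomPinned`, cell ym3-torus).

[folklore]; def-free; no named fact.
-/

set_option autoImplicit false

namespace Summit.QuantumFields.YangMills.Theorems.AnchorGap.TreeSum

open Finset Literature.Probability.LatticeModels

variable {β : Type} [Fintype β] [DecidableEq β] [LinearOrder β]

/-- **One cardinality at a time** (TREESUM against a GBND-shaped majorant):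
`Σ_{X ∋ c, |X| = n} F X ≤ A qⁿ · n^{n−2}/(n−1)! · n · Y^{n−1}`. [folklore] -/
theorem sum_pinned_card_le {y : Sym2 β → ℝ} (hy : ∀ ℓ, 0 ≤ y ℓ) {Y : ℝ}
    (hY : ∀ a : β, ∑ a', y s(a, a') ≤ Y) {F : Finset β → ℝ} {A q : ℝ} (hA : 0 ≤ A) (hq : 0 ≤ q)
    (hF : ∀ (X : Finset β) (hX : X.Nonempty), 2 ≤ X.card →
      F X ≤ A * q ^ X.card * ∑ T ∈ BattleFederbush.lineSets (X.min' hX) X, ∏ ℓ ∈ T, y ℓ)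
    (c : β) {n : ℕ} (hn : 2 ≤ n) :
    ∑ X ∈ Finset.univ.powerset.filter (fun X : Finset β => c ∈ X ∧ X.card = n), F X
      ≤ A * q ^ n * ((n : ℝ) ^ (n - 2) / (Nat.factorial (n - 1) : ℝ) * (n : ℝ) * Y ^ (n - 1)) := by
  have hT := stub_treeWeightPolymerSum β y hy Y hY c n hn
  calc ∑ X ∈ Finset.univ.powerset.filter (fun X : Finset β => c ∈ X ∧ X.card = n), F X
      ≤ ∑ X ∈ Finset.univ.powerset.filter (fun X : Finset β => c ∈ X ∧ X.card = n),
          A * q ^ n * (if hX : X.Nonempty then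
            ∑ T ∈ BattleFederbush.lineSets (X.min' hX) X, ∏ ℓ ∈ T, y ℓ else 0) := by
        refine Finset.sum_le_sum fun X hX => ?_
        obtain ⟨hc, hcard⟩ := (Finset.mem_filter.1 hX).2
        have hne : X.Nonempty := ⟨c, hc⟩
        rw [dif_pos hne, ← hcard]
        exact hF X hne (hcard ▸ hn)
    _ = A * q ^ n * ∑ X ∈ Finset.univ.powerset.filter (fun X : Finset β => c ∈ X ∧ X.card = n),
          (if hX : X.Nonempty then ∑ T ∈ BattleFederbush.lineSets (X.min' hX) X, ∏ ℓ ∈ T, y ℓ else 0) := by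
        rw [Finset.mul_sum]
    _ ≤ A * q ^ n * ((n : ℝ) ^ (n - 2) / (Nat.factorial (n - 1) : ℝ) * (n : ℝ) * Y ^ (n - 1)) :=
        mul_le_mul_of_nonneg_left hT (by positivity)

/-- `n^{n−2} · n / (n−1)! ≤ eⁿ` for `n ≥ 2` (from `nⁿ/n! ≤ eⁿ`, `Real.pow_div_factorial_le_exp`).
[folklore] -/
theorem pow_div_factorial_le_exp_pow {n : ℕ} (hn : 2 ≤ n) :
    (n : ℝ) ^ (n - 2) / (Nat.factorial (n - 1) : ℝ) * (n : ℝ) ≤ Real.exp 1 ^ n := by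
  have h := Real.pow_div_factorial_le_exp (n : ℝ) (Nat.cast_nonneg n) n
  rw [← Real.exp_nat_mul, mul_one]
  obtain ⟨m, rfl⟩ : ∃ m, n = m + 2 := ⟨n - 2, by omega⟩
  have hfac : (Nat.factorial (m + 2) : ℝ) = ((m + 2 : ℕ) : ℝ) * (Nat.factorial (m + 2 - 1) : ℝ) := by
    rw [show m + 2 - 1 = m + 1 from rfl, Nat.factorial_succ (m + 1)]; push_cast; ring
  have hn0 : (0 : ℝ) < ((m + 2 : ℕ) : ℝ) := by positivity
  have hf0 : (0 : ℝ) < (Nat.factorial (m + 2 - 1) : ℝ) := by exact_mod_cast Nat.factorial_pos _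
  have key : ((m + 2 : ℕ) : ℝ) ^ (m + 2 - 2) / (Nat.factorial (m + 2 - 1) : ℝ) * ((m + 2 : ℕ) : ℝ)
      = ((m + 2 : ℕ) : ℝ) ^ (m + 2) / (Nat.factorial (m + 2) : ℝ) := by
    rw [hfac, show m + 2 - 2 = m from rfl]
    field_simp
    ring
  rw [key]
  exact h

/-- **Summing over the cardinality**: `Σ_{X ∋ c, 2 ≤ |X|} F X ≤ A · Σ_{n ∈ [2, |β|+1)} (qe)ⁿ Y^{n−1}`.
[folklore] -/
theorem sum_pinned_le_sum_Ico {y : Sym2 β → ℝ} (hy : ∀ ℓ, 0 ≤ y ℓ) {Y : ℝ}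
    (hY : ∀ a : β, ∑ a', y s(a, a') ≤ Y) {F : Finset β → ℝ} {A q : ℝ} (hA : 0 ≤ A) (hq : 0 ≤ q)
    (hF : ∀ (X : Finset β) (hX : X.Nonempty), 2 ≤ X.card →
      F X ≤ A * q ^ X.card * ∑ T ∈ BattleFederbush.lineSets (X.min' hX) X, ∏ ℓ ∈ T, y ℓ)
    (c : β) :
    ∑ X ∈ Finset.univ.powerset.filter (fun X : Finset β => c ∈ X ∧ 2 ≤ X.card), F X
      ≤ A * ∑ n ∈ Finset.Ico 2 (Fintype.card β + 1), (q * Real.exp 1) ^ n * Y ^ (n - 1) := by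
  have hY0 : 0 ≤ Y := le_trans (Finset.sum_nonneg fun a' _ => hy s(c, a')) (hY c)
  -- split by cardinality
  have hsplit : ∑ X ∈ Finset.univ.powerset.filter (fun X : Finset β => c ∈ X ∧ 2 ≤ X.card), F X
      = ∑ n ∈ Finset.Ico 2 (Fintype.card β + 1),
          ∑ X ∈ Finset.univ.powerset.filter (fun X : Finset β => c ∈ X ∧ X.card = n), F X := by
    rw [← Finset.sum_fiberwise_of_maps_to (g := fun X : Finset β => X.card)
      (t := Finset.Ico 2 (Fintype.card β + 1))]
    · refine Finset.sum_congr rfl fun n hn => Finset.sum_congr ?_ fun _ _ => rfl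
      have hn2 : 2 ≤ n := (Finset.mem_Ico.1 hn).1
      ext X
      simp only [Finset.mem_filter, Finset.mem_powerset, Finset.subset_univ, true_and]
      constructor
      · rintro ⟨⟨hc, -⟩, hcard⟩; exact ⟨hc, hcard⟩
      · rintro ⟨hc, hcard⟩; exact ⟨⟨hc, by omega⟩, hcard⟩
    · intro X hX
      obtain ⟨hc, h2⟩ := (Finset.mem_filter.1 hX).2
      exact Finset.mem_Ico.2 ⟨h2, Nat.lt_succ_of_le (Finset.card_le_univ X)⟩
  rw [hsplit, Finset.mul_sum]
  refine Finset.sum_le_sum fun n hn => ?_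
  have hn2 : 2 ≤ n := (Finset.mem_Ico.1 hn).1
  refine (sum_pinned_card_le hy hY hA hq hF c hn2).trans ?_
  have hE := pow_div_factorial_le_exp_pow hn2
  have hYp : 0 ≤ Y ^ (n - 1) := pow_nonneg hY0 _
  calc A * q ^ n * ((n : ℝ) ^ (n - 2) / (Nat.factorial (n - 1) : ℝ) * (n : ℝ) * Y ^ (n - 1))
      = A * (q ^ n * ((n : ℝ) ^ (n - 2) / (Nat.factorial (n - 1) : ℝ) * (n : ℝ)) * Y ^ (n - 1)) := by
        ring
    _ ≤ A * (q ^ n * Real.exp 1 ^ n * Y ^ (n - 1)) := by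
        refine mul_le_mul_of_nonneg_left (mul_le_mul_of_nonneg_right
          (mul_le_mul_of_nonneg_left hE (pow_nonneg hq n)) hYp) hA
    _ = A * ((q * Real.exp 1) ^ n * Y ^ (n - 1)) := by rw [mul_pow]

/-- A finite geometric tail: `Σ_{n ∈ [2, N)} xⁿ⁻¹ ≤ x / (1 − x)` for `0 ≤ x < 1`. [folklore] -/
theorem sum_Ico_pow_pred_le {x : ℝ} (hx0 : 0 ≤ x) (hx1 : x < 1) (N : ℕ) :
    ∑ n ∈ Finset.Ico 2 N, x ^ (n - 1) ≤ x / (1 - x) := by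
  rw [Finset.sum_Ico_eq_sum_range]
  have hre : ∀ k ∈ Finset.range (N - 2), x ^ (2 + k - 1) = x * x ^ k := fun k _ => by
    rw [show 2 + k - 1 = k + 1 by omega, pow_succ, mul_comm]
  rw [Finset.sum_congr rfl hre, ← Finset.mul_sum, div_eq_mul_inv]
  exact mul_le_mul_of_nonneg_left
    (sum_le_hasSum _ (fun k _ => pow_nonneg hx0 k) (hasSum_geometric_of_lt_one hx0 hx1)) hx0

/-- **The per-atom pinned tree-sum criterion in closed form.** With `F` of GBND shape and row sums
`≤ Y`: `Σ_{X ∋ c, 2 ≤ |X|} F X ≤ A (qe)² Y / (1 − qeY)` whenever `qeY < 1` — so the pinned sum is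
`≤ τ` as soon as `Y ≤ τ / (A(qe)² + τ qe)`; this is the hypothesis of the Kotecký–Preiss packaging of the
atom gas. [folklore] -/
theorem sum_pinned_le_geometric {y : Sym2 β → ℝ} (hy : ∀ ℓ, 0 ≤ y ℓ) {Y : ℝ}
    (hY : ∀ a : β, ∑ a', y s(a, a') ≤ Y) {F : Finset β → ℝ} {A q : ℝ} (hA : 0 ≤ A) (hq : 0 ≤ q)
    (hF : ∀ (X : Finset β) (hX : X.Nonempty), 2 ≤ X.card →
      F X ≤ A * q ^ X.card * ∑ T ∈ BattleFederbush.lineSets (X.min' hX) X, ∏ ℓ ∈ T, y ℓ)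
    (hsmall : q * Real.exp 1 * Y < 1) (c : β) :
    ∑ X ∈ Finset.univ.powerset.filter (fun X : Finset β => c ∈ X ∧ 2 ≤ X.card), F X
      ≤ A * (q * Real.exp 1) ^ 2 * Y / (1 - q * Real.exp 1 * Y) := by
  have hY0 : 0 ≤ Y := le_trans (Finset.sum_nonneg fun a' _ => hy s(c, a')) (hY c)
  have hqe : 0 ≤ q * Real.exp 1 := mul_nonneg hq (Real.exp_pos 1).le
  have hx0 : 0 ≤ q * Real.exp 1 * Y := mul_nonneg hqe hY0
  refine (sum_pinned_le_sum_Ico hy hY hA hq hF c).trans ?_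
  have hterm : ∀ n ∈ Finset.Ico 2 (Fintype.card β + 1),
      (q * Real.exp 1) ^ n * Y ^ (n - 1) = (q * Real.exp 1) * (q * Real.exp 1 * Y) ^ (n - 1) := by
    intro n hn
    have hn2 : 2 ≤ n := (Finset.mem_Ico.1 hn).1
    obtain ⟨m, rfl⟩ : ∃ m, n = m + 1 := ⟨n - 1, by omega⟩
    rw [Nat.add_sub_cancel, pow_succ, mul_pow]; ring
  rw [Finset.sum_congr rfl hterm, ← Finset.mul_sum]
  have hgeo := sum_Ico_pow_pred_le hx0 hsmall (Fintype.card β + 1)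
  calc A * (q * Real.exp 1 * ∑ n ∈ Finset.Ico 2 (Fintype.card β + 1), (q * Real.exp 1 * Y) ^ (n - 1))
      ≤ A * (q * Real.exp 1 * ((q * Real.exp 1 * Y) / (1 - q * Real.exp 1 * Y))) :=
        mul_le_mul_of_nonneg_left (mul_le_mul_of_nonneg_left hgeo hqe) hA
    _ = A * (q * Real.exp 1) ^ 2 * Y / (1 - q * Real.exp 1 * Y) := by ring

end Summit.QuantumFields.YangMills.Theorems.AnchorGap.TreeSum
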